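import Literature.AnabelianGeometry.SemiGraphs.QuasiTemperoidsQDPairs
import Literature.AnabelianGeometry.SemiGraphs.QuasiTemperoidsNondegenerateObj
import HarnessLib

/-!
# Semi-graphs of anabelioids, Appendix p. 79 / Definition A.3 (i): connected components `C → A`
# (kernel closure census of the predicate `IsComponent`)

Mochizuki, *Semi-graphs of anabelioids*, Publ. RIMS **42** (2006) 221–322, Appendix
"Quasi-temperoids", manuscript p. 79 ("`π₀(A)`, the set of connected components of `A`") and
Definition A.3 (i) p. 82 [cite: MochizukiSemiAnbd2006, Appendix p.79]. In the tree, "`ι : C → A` is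
a connected component of `A`" is the predicate `IsComponent ι` (`QuasiTemperoidsQDPairs.lean`): `C` is
connected and `A ≅ C ⊔ D` with `ι` the first coprojection, for some `D`.

PROOF-ONLY companion (no definitions). `IsComponent` is a PREDICATE on arrows (vocabulary), not a
published theorem; it sits in the abc-iut cell's frozen fact list as row F-1625 (status
"conditional" by a conclusion-head match: the tree's producers `IsComponent.iso_comp`,
`IsComponent.map_equivalence`, `isComponent_orbitIncl`, … all carry hypotheses, as they must). This
file records in the kernel what there is to know about it:

* `IsComponent.isConnectedObj`, `not_isComponent_of_isInitial` — a component has a connected, in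
  particular non-initial, source (any category);
* `IsComponent.of_isIso_of_isInitial`, `isComponent_id_of_isConnectedObj` — an isomorphism out of a
  connected object (e.g. `𝟙 A`, `A` connected) IS a component as soon as an initial object is
  available for the complementary summand (any category; in a connected quasi-temperoid initial
  objects exist: `IsConnectedQuasiTemperoid.isComponent_id`);
* hence the UNIVERSAL CLOSURE of the predicate ("every arrow is a connected component") is FALSE
  (`not_forall_isComponent`: the identity of the empty type in the category of types), while the
  predicate is inhabited (`types_isComponent_id_punit`: the identity of the one-point type) — the row
  is a schema to apply at instances, not an assumption to bind unapplied.

Nothing here bears on, or takes a side on, [IUTchIII] Cor. 3.12; typed ≠ proved.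
-/

open CategoryTheory CategoryTheory.Limits

namespace Literature.AnabelianGeometry.SemiGraphs

open Literature.AlgebraicGeometry.Frobenioids (IsConnectedObj IsNonemptyObj)
open Literature.AlgebraicGeometry.Frobenioids.QuasiTemperoid (IsConnectedQuasiTemperoid)

universe v₁ u₁ u

/-! ### Any category -/

section AnyCategory

variable {Q : Type u₁} [Category.{v₁} Q]

/-- The source of a connected component is connected (first clause of the definition, for use by
name). [cite: MochizukiSemiAnbd2006, Appendix p.79] -/
theorem IsComponent.isConnectedObj {C A : Q} {ι : C ⟶ A} (h : IsComponent ι) : IsConnectedObj C :=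
  h.1

/-- An arrow out of an empty [initial] object is never a connected component (connected objects are
nonempty). [cite: MochizukiSemiAnbd2006, Appendix p.79] -/
theorem not_isComponent_of_isInitial {C A : Q} (ι : C ⟶ A) (hC : IsInitial C) : ¬ IsComponent ι :=
  fun h => h.1.1.false hC

/-- An ISOMORPHISM out of a connected object is a connected component: `A ≅ C ≅ C ⊔ ∅` for any initial
object `∅` (the complementary summand). [cite: MochizukiSemiAnbd2006, Appendix p.79] -/
theorem IsComponent.of_isIso_of_isInitial {C A E : Q} (ι : C ⟶ A) [IsIso ι] (hC : IsConnectedObj C)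
    (hE : IsInitial E) : IsComponent ι :=
  ⟨hC, E, hE.to A, (BinaryCofan.isColimit_iff_isIso_inl hE (BinaryCofan.mk ι (hE.to A))).mpr
    (by rw [BinaryCofan.mk_inl]; exact ‹IsIso ι›)⟩

/-- In a category with an initial object, the identity of a connected object `A` is a connected
component of `A` (`A ≅ A ⊔ ∅`; so `π₀(A)` is a singleton for `A` connected, cf.
`IsComponent.isIso_of_isConnectedObj`). [cite: MochizukiSemiAnbd2006, Appendix p.79] -/
theorem isComponent_id_of_isConnectedObj [HasInitial Q] {A : Q} (hA : IsConnectedObj A) :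
    IsComponent (𝟙 A) :=
  IsComponent.of_isIso_of_isInitial (𝟙 A) hA initialIsInitial

end AnyCategory

/-! ### Connected quasi-temperoids -/

section ConnectedQuasiTemperoid

variable {Q : Type u₁} [Category.{v₁} Q]

/-- In a connected quasi-temperoid (which has an initial object) the identity of every connected
object is a connected component. [cite: MochizukiSemiAnbd2006, Def A.3(i) p.82] -/
theorem _root_.Literature.AlgebraicGeometry.Frobenioids.QuasiTemperoid.IsConnectedQuasiTemperoid.isComponent_id
    (hQ : IsConnectedQuasiTemperoid.{v₁, u₁, u} Q) {A : Q} (hA : IsConnectedObj A) :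
    IsComponent (𝟙 A) :=
  haveI := hQ.hasInitial
  isComponent_id_of_isConnectedObj hA

/-- In a connected quasi-temperoid the identity of the initial object `⊥` is NOT a connected component
— so not every arrow of a quasi-temperoid is a component. [cite: MochizukiSemiAnbd2006, Def A.3(i) p.82] -/
theorem _root_.Literature.AlgebraicGeometry.Frobenioids.QuasiTemperoid.IsConnectedQuasiTemperoid.not_isComponent_id_initial
    (hQ : IsConnectedQuasiTemperoid.{v₁, u₁, u} Q) :
    haveI := hQ.hasInitial; ¬ IsComponent (𝟙 (⊥_ Q)) :=
  haveI := hQ.hasInitial; not_isComponent_of_isInitial _ initialIsInitial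

end ConnectedQuasiTemperoid

/-! ### The category of types: the cheapest kernel witnesses -/

section Types

/-- In the category of types the identity of the one-point type is a connected component (the
predicate is inhabited). [cite: MochizukiSemiAnbd2006, Appendix p.79] -/
theorem types_isComponent_id_punit : IsComponent (𝟙 (PUnit.{u + 1} : Type u)) :=
  isComponent_id_of_isConnectedObj types_isConnectedObj_punit

/-- In the category of types the identity of the empty type is NOT a connected component.
[cite: MochizukiSemiAnbd2006, Appendix p.79] -/
theorem types_not_isComponent_id_pempty : ¬ IsComponent (𝟙 (PEmpty.{u + 1} : Type u)) :=
  not_isComponent_of_isInitial _ Types.isInitialPEmpty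

/-- F-1625 is a PREDICATE, not a theorem: its universal closure ("every arrow of every category is a
connected component") is FALSE — witness the identity of the empty type (and, in the paper's own
setting, the identity of any empty object of a connected quasi-temperoid,
`IsConnectedQuasiTemperoid.not_isComponent_id_initial`). [cite: MochizukiSemiAnbd2006, Appendix p.79] -/
theorem not_forall_isComponent :
    ¬ ∀ (Q : Type (u + 1)) [Category.{u} Q] (C A : Q) (ι : C ⟶ A), IsComponent ι :=
  fun h => types_not_isComponent_id_pempty.{u} (h (Type u) PEmpty PEmpty (𝟙 _))

end Types

end Literature.AnabelianGeometry.SemiGraphs
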